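import Literature.MathematicalPhysics.QuantumFieldTheory.Balaban1983to89.B11Eq44COperatorTorus

/-!
# `Balaban1983to89.B11Eq44RegimePerLattice` — T. Bałaban, *The variational problem and background fields in renormalization group method for
# lattice gauge theories*, Commun. Math. Phys. **102** (1985) 277–309 [Balaban1985Variational]: Prop. 3 p. 289, (45)–(52) p. 285, (54) p. 286 —
# THE PER-LATTICE SCALARS OF THE SECT. C REGIME EXIST: at every fixed lattice, every background in the (31)-window and EVERY kernel `k_H`, the
# row-sum letter `b` and the two scalars `a_C`, `ε_C` of `B11Eq44COperatorTorus.regime_sectC` are INHABITED, so the regime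
# `Regime (HopAd … U k_H) 0 (Cc …) b 0 (2097152(d+1)²) (1/(512(d+1))) 0 a_C ε_C` holds from the structural hypotheses alone

statement-level skeleton of published theorems with citation tags; proofs where landed; nothing here is a claim about the Yang–Mills mass gap

PDF held: `paper:balaban1985-cmp102-variational-background` (journal page = PDF page + 276); pp. 284–289 read by this seat in the held text layer
(p0009–p0013; 2026-08-21/22).

THE PRINT (verbatim, held text layer p0013 = p. 289 L18–20; p0009 = p. 285 L16–17).  p. 289, Prop. 3: *«The transformation (47) satisfying
the identity (48), i.e. linearizing the averaging operation Q(LʲηA′), is defined and analytic for A′ satisfying (43) with ε₃ sufficiently small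
(e.g. 18C₂B₀dc₁(½)ε₃ ≤ 1, 2ε₃ ≤ c₄).»*; p. 285: *«and the Theorem 3.12 from [5] implies |HB| ≤ B₀(Lʲη)⁻¹|B|, |∇HB| ≤ B₀(Lʲη)⁻²|B| on Ω_j. (46)»*.
WHAT IS PROVED is NOT print's uniformity in the lattice: it is the PER-LATTICE existence of the letters the crew's Sect. C regime file displays.

WHY THIS FILE (cell context).  ne9-leaf-03's `B11Eq44COperatorTorus.regime_sectC` (PART E of the NE9 (L3) chart) proves lit-balaban's
`B11Eq174Chart.Regime (HopAd (L:ℝ) η levB lev₀ lev₁ U k_H) 0 (Cc L m η U lev₀ lev₁ (nabla115 η U) levB) b 0 C₂ c₄ 0 a_C ε_C` — the hypotheses of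
the (50)/(116)-type contraction behind `NE9B11ChartAnalytic.chart47_spec` ∕ `chartHB_triple_of_twoRegimes` and the `RC` binder of the (L3) W-slot
theorems (`B11Ineq73KernelLettersPerLattice.exists_quadAnalytic_W80`, `B11Eq98V0LettersPerLattice.exists_quadAnalytic_W80_structural`) — under
DISPLAYED letters: `0 ≤ b` bounding the two ROW-SUM families of the kernel `k_H` and of its derived kernel `∇k_H` ((46)), and three NUMERICAL
conditions `dom` ∕ `self` ∕ `contr` on `(b, C₂, c₄, a_C, ε_C)` (the (L7) arithmetic).  On a FINITE lattice all of them are inhabited outright: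
`b` is a finite maximum of finitely many row sums (ANY kernel), and `a_C = ε_C = t` with `t = min (c₄/4) (1/(16(b+1)C₂))` solves the arithmetic.
So the Sect. C regime — hence the `RC` binder of the W-slot files at `(H, C) := (HopAd … k_H, Cc …)` — holds per lattice from structure alone
(`1 ≤ L`, `α ≤ 1/128`, the (31)-window `hU1` ∕ `hreg`, `1 ≤ lev₀`).

WHAT IS PROVED (sorry-free; no definition; no `Prop` placeholder; nothing of [B11]'s inequalities asserted).
* §1 **`exists_rowSum_letter`** — for ANY kernel `k_H`: `∃ b ≥ 0` bounding both row-sum families of `regime_sectC` VERBATIM ([folklore]: finite range).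
* §2 **`exists_scalars`** — the (L7) arithmetic: `0 ≤ b`, `0 < C₂`, `0 < c₄` ⇒ `∃ t > 0` with `2(t+t) ≤ c₄`, `b·C₂·(t+t)² ≤ t`, `4b·C₂·(t+t) < 1` ([folklore]).
* §3 **`exists_regime_sectC_of_rowSum`** — the regime with the row-sum letter `b` DISPLAYED and the scalars CHOSEN: `∃ a_C ε_C > 0, Regime …`.
* §4 **`exists_regime_sectC`** — everything chosen: `∃ b a_C ε_C, 0 ≤ b ∧ 0 < a_C ∧ 0 < ε_C ∧ Regime (HopAd … U k_H) 0 (Cc …) b 0 (2097152(d+1)²)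
  (1/(512(d+1))) 0 a_C ε_C`, for ANY `k_H`, under `regime_sectC`'s structural hypotheses ONLY.
* §5 **`exists_sectC_data`** — §4 together with ne9-leaf-03's `prop4Hyp_Cc` and `analyticOnNhd_Cc` (BY NAME): the three Sect. C inputs `RC`,
  `Prop4Hyp C C₂ c₄`, `C` analytic on `{‖Y‖ < c₄}` of the (L3) W-slot ∕ chart theorems at `(H, C) := (HopAd … U k_H, Cc …)`, per lattice.
* §6 `exists_regime_sectC_one` — NON-VACUITY: the flat background `U ≡ 1` (`α = 0`), hypotheses `1 ≤ L`, `1 ≤ lev₀` only.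
HONEST SCOPE.  (i) PER-LATTICE scalars only: `b` is the worst row sum of ONE kernel on ONE lattice — NO (46)-type decay, NO uniformity in the
lattice, NO «d and L only»; `a_C`, `ε_C` shrink with `b`.  (ii) The kernel `k_H` is ARBITRARY: nothing says it is the kernel of print's `H` of (45)
(that identification is the (L4) row of the chart, not this file).  (iii) Composition BY NAME of `regime_sectC`; its own HONEST SCOPE (the `quad`
clause of `Cc` proved at the (31)-window; `C₂`, `c₄` the scheme's explicit numbers) is inherited verbatim.  NE9 is NOT printed ∕ NOT proved here;
finite torus only; NOT infinite volume, NOT mass gap, NOT Clay.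
-/

namespace Literature.MathematicalPhysics.QuantumFieldTheory.Balaban1983to89.B11Eq44RegimePerLattice

open B11Eq115Space B11Eq44COperatorTorus
open B11Prop6Scheme (Prop4Hyp)
open B11Eq45HOperator (HopAd gradKernel)   open B11Eq115KernelOp (rowSum)   open B11Eq174Chart (Regime)
open B11Eq111FrakG (nabla115)   open B9Eq33CovDerivVector (adTransport)
open B9Eq319QprimeTorus (fineP)   open B9SectCLatticeCarrier (Bond)   open B4Sect5Torus (TSite)   open B7Prop1Explicit (U1 Wcx boxVec)
open B9Eq315QTorus (perCfg cornerSite)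

variable {d : ℕ} {𝔸 : Type*} [NormedRing 𝔸] [NormedAlgebra ℂ 𝔸] [CompleteSpace 𝔸] [NormOneClass 𝔸] [FiniteDimensional ℂ 𝔸]
  (L : ℕ) (m : Fin d → ℕ) [∀ i, NeZero (fineP L m i)] (η : ℝ) (U : Bond d (fineP L m) → 𝔸ˣ)
  (lev₀ : Bond d (fineP L m) → ℕ) (lev₁ : Bond d (fineP L m) × Fin d → ℕ) (levB : Bond d m → ℕ) [Fact (0 < (L : ℝ))] [Fact (0 < η)]
  (hL : 1 ≤ L) {α : ℝ} (hα : α ≤ 1 / 128)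
  (hU1 : ∀ (x : B7Prop1Explicit.Site d) (κ : Fin d), perCfg (fineP L m) U x κ ∈ U1 𝔸)
  (hreg : ∀ (y : TSite d m) (κ : Fin d) (r : Fin d → Fin L),
    ‖((Wcx L (perCfg (fineP L m) U) (cornerSite L y) κ (boxVec L r) : 𝔸ˣ) : 𝔸) - 1‖ ≤ α)
  (hlev : ∀ b, 1 ≤ lev₀ b)

/-! ## §1 The row-sum letter `b` of (46) exists per lattice, for any kernel -/

omit [CompleteSpace 𝔸] [NormOneClass 𝔸] [∀ i, NeZero (fineP L m i)] [Fact (0 < (L : ℝ))] [Fact (0 < η)] in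
/-- **The row-sum letter exists per lattice.**  For ANY operator-valued kernel `k_H` on the fine bonds × coarse bonds of one lattice there is
`b ≥ 0` bounding the two row-sum families displayed by `regime_sectC` ∕ `B11Eq45HOperator.norm_HopAd_le`: the rows of `k_H` against the weights
`(levWeight levB 0, levWeight lev₀ 1)` and the rows of the derived kernel `∇k_H = gradKernel (η⁻¹) (adTransport U) k_H` against
`(levWeight levB 0, levWeight lev₁ 2)` — a finite maximum ([folklore]; NOT the (46) decay, NOT uniform in the lattice).
[cite: Balaban1985Variational, (46) p.285, Prop. 3 p.289] -/
theorem exists_rowSum_letter (kH : Bond d (fineP L m) → Bond d m → (𝔸 →L[ℂ] 𝔸)) :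
    ∃ b : ℝ, 0 ≤ b ∧ (∀ x, rowSum (levWeight (L : ℝ) η levB 0) (levWeight (L : ℝ) η lev₀ 1) kH x ≤ b) ∧
      ∀ p, rowSum (levWeight (L : ℝ) η levB 0) (levWeight (L : ℝ) η lev₁ 2) (gradKernel ((η : ℂ)⁻¹) (adTransport U) kH) p ≤ b := by
  obtain ⟨M₀, hM₀⟩ := (Set.finite_range fun x => rowSum (levWeight (L : ℝ) η levB 0) (levWeight (L : ℝ) η lev₀ 1) kH x).bddAbove
  obtain ⟨M₁, hM₁⟩ :=
    (Set.finite_range fun p => rowSum (levWeight (L : ℝ) η levB 0) (levWeight (L : ℝ) η lev₁ 2) (gradKernel ((η : ℂ)⁻¹) (adTransport U) kH) p).bddAbove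
  refine ⟨max 0 (max M₀ M₁), le_max_left _ _, fun x => ?_, fun p => ?_⟩
  · exact (hM₀ ⟨x, rfl⟩).trans ((le_max_left _ _).trans (le_max_right _ _))
  · exact (hM₁ ⟨p, rfl⟩).trans ((le_max_right _ _).trans (le_max_right _ _))

/-! ## §2 The (L7) arithmetic of the scheme's scalars -/

/-- **The (L7) arithmetic is solvable.**  Given the row-sum letter `b ≥ 0` and positive scheme constants `C₂`, `c₄`, the choice
`a_C = ε_C = t := min (c₄/4) (1/(16(b+1)C₂))` satisfies the three numerical conditions of `regime_sectC`: `dom` `2(ε_C + a_C) ≤ c₄`,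
`self` `b·C₂·(ε_C + a_C)² ≤ ε_C`, `contr` `4b·C₂·(ε_C + a_C) < 1` ([folklore] arithmetic; print's «for ε₃ sufficiently small, e.g. 18C₂B₀dc₁(½)ε₃ ≤ 1,
2ε₃ ≤ c₄», here with per-lattice letters). [cite: Balaban1985Variational, Prop. 3 p.289, (52) p.285] -/
theorem exists_scalars (b C₂ c₄ : ℝ) (hb : 0 ≤ b) (hC₂ : 0 < C₂) (hc₄ : 0 < c₄) :
    ∃ t : ℝ, 0 < t ∧ 2 * (t + t) ≤ c₄ ∧ b * C₂ * (t + t) ^ 2 ≤ t ∧ 4 * b * C₂ * (t + t) < 1 := by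
  set t : ℝ := min (c₄ / 4) (1 / (16 * (b + 1) * C₂)) with ht_def
  have ht : 0 < t := lt_min (by positivity) (by positivity)
  have h16 : b * C₂ * t ≤ 1 / 16 := by
    have h1 : b * C₂ * t ≤ b * C₂ * (1 / (16 * (b + 1) * C₂)) := mul_le_mul_of_nonneg_left (min_le_right _ _) (by positivity)
    have h2 : b * C₂ * (1 / (16 * (b + 1) * C₂)) ≤ 1 / 16 := by
      rw [mul_one_div, div_le_iff₀ (by positivity)]
      linarith [hC₂.le]
    exact h1.trans h2
  refine ⟨t, ht, ?_, ?_, ?_⟩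
  · linarith [min_le_left (c₄ / 4) (1 / (16 * (b + 1) * C₂))]
  · have h4 : 4 * t * (b * C₂ * t) ≤ 4 * t * (1 / 16) := mul_le_mul_of_nonneg_left h16 (by positivity)
    nlinarith [h4, ht.le]
  · linarith [h16]

/-! ## §3 The Sect. C regime with the row-sum letter displayed and the scalars chosen -/

include hL hα hU1 hreg hlev in
/-- **The Sect. C regime per lattice, row-sum letter displayed.**  Under `regime_sectC`'s structural hypotheses (`1 ≤ L`, `α ≤ 1/128`, the
(31)-window `hU1` ∕ `hreg`, `1 ≤ lev₀`) and the DISPLAYED row-sum letter `b ≥ 0` of the kernel `k_H` and its derived kernel, the scalars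
`a_C`, `ε_C > 0` of the regime EXIST: `Regime (HopAd … U k_H) 0 (Cc …) b 0 (2097152(d+1)²) (1/(512(d+1))) 0 a_C ε_C` — composition BY NAME of
`regime_sectC` with §2. [cite: Balaban1985Variational, Prop. 3 p.289, (45)–(52) p.285, (54) p.286] -/
theorem exists_regime_sectC_of_rowSum (kH : Bond d (fineP L m) → Bond d m → (𝔸 →L[ℂ] 𝔸)) {b : ℝ} (hb : 0 ≤ b)
    (h₀ : ∀ x, rowSum (levWeight (L : ℝ) η levB 0) (levWeight (L : ℝ) η lev₀ 1) kH x ≤ b)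
    (h₁ : ∀ p, rowSum (levWeight (L : ℝ) η levB 0) (levWeight (L : ℝ) η lev₁ 2) (gradKernel ((η : ℂ)⁻¹) (adTransport U) kH) p ≤ b) :
    ∃ aC εC : ℝ, 0 < aC ∧ 0 < εC ∧
      Regime (HopAd (L : ℝ) η levB lev₀ lev₁ U kH) 0 (Cc L m η U lev₀ lev₁ (nabla115 η U) levB) b 0
        (2097152 * ((d : ℝ) + 1) ^ 2) (1 / (512 * ((d : ℝ) + 1))) 0 aC εC := by
  obtain ⟨t, ht, hdom, hself, hcontr⟩ := exists_scalars b (2097152 * ((d : ℝ) + 1) ^ 2) (1 / (512 * ((d : ℝ) + 1))) hb (by positivity) (by positivity)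
  exact ⟨t, t, ht, ht, regime_sectC L m η U lev₀ lev₁ levB hL hα hU1 hreg hlev kH hb h₀ h₁ ht.le hdom hself hcontr⟩

/-! ## §4 The Sect. C regime per lattice, everything chosen -/

include hL hα hU1 hreg hlev in
/-- **THE SECT. C REGIME HOLDS PER LATTICE FROM STRUCTURE ALONE.**  For ANY kernel `k_H`, under `regime_sectC`'s structural hypotheses ONLY
(`1 ≤ L`, `α ≤ 1/128`, the (31)-window `hU1` ∕ `hreg`, `1 ≤ lev₀`): `∃ b a_C ε_C, 0 ≤ b ∧ 0 < a_C ∧ 0 < ε_C ∧ Regime (HopAd (L:ℝ) η levB lev₀ lev₁ U k_H) 0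
(Cc L m η U lev₀ lev₁ (nabla115 η U) levB) b 0 (2097152(d+1)²) (1/(512(d+1))) 0 a_C ε_C` — the `RC` binder of the (L3) W-slot theorems at the
T-slot's own `(H, C)`, per lattice (§1 + §3; PER-LATTICE letters, NOT «d and L only»). [cite: Balaban1985Variational, Prop. 3 p.289, (45)–(52) p.285, (54) p.286] -/
theorem exists_regime_sectC (kH : Bond d (fineP L m) → Bond d m → (𝔸 →L[ℂ] 𝔸)) :
    ∃ b aC εC : ℝ, 0 ≤ b ∧ 0 < aC ∧ 0 < εC ∧
      Regime (HopAd (L : ℝ) η levB lev₀ lev₁ U kH) 0 (Cc L m η U lev₀ lev₁ (nabla115 η U) levB) b 0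
        (2097152 * ((d : ℝ) + 1) ^ 2) (1 / (512 * ((d : ℝ) + 1))) 0 aC εC := by
  obtain ⟨b, hb, h₀, h₁⟩ := exists_rowSum_letter L m η U lev₀ lev₁ levB kH
  obtain ⟨aC, εC, haC, hεC, RC⟩ := exists_regime_sectC_of_rowSum L m η U lev₀ lev₁ levB hL hα hU1 hreg hlev kH hb h₀ h₁
  exact ⟨b, aC, εC, hb, haC, hεC, RC⟩

/-! ## §5 The Sect. C data of the (L3) W-slot theorems at the T-slot's own `(H, C)`, per lattice -/

include hL hα hU1 hreg hlev in
/-- **THE SECT. C DATA PER LATTICE.**  For ANY kernel `k_H`, under the structural hypotheses ONLY, the three Sect. C inputs of the (L3) W-slot ∕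
chart theorems at `(H, C) := (HopAd … U k_H, Cc …)` hold together: the regime `RC` (§4), lit-balaban's `Prop4Hyp C C₂ c₄` (ne9-leaf-03's
`prop4Hyp_Cc`, BY NAME) and the analyticity of `C` on `{‖Y‖ < c₄}` (`analyticOnNhd_Cc`, BY NAME) — `C₂ = 2097152(d+1)²`, `c₄ = 1/(512(d+1))`;
PER-LATTICE scalars, NOT «d and L only». [cite: Balaban1985Variational, Prop. 3 p.289, (44)–(52) p.285, p.286] -/
theorem exists_sectC_data (kH : Bond d (fineP L m) → Bond d m → (𝔸 →L[ℂ] 𝔸)) :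
    ∃ b aC εC : ℝ, 0 ≤ b ∧ 0 < aC ∧ 0 < εC ∧
      Regime (HopAd (L : ℝ) η levB lev₀ lev₁ U kH) 0 (Cc L m η U lev₀ lev₁ (nabla115 η U) levB) b 0
        (2097152 * ((d : ℝ) + 1) ^ 2) (1 / (512 * ((d : ℝ) + 1))) 0 aC εC ∧
      Prop4Hyp (Cc L m η U lev₀ lev₁ (nabla115 η U) levB) (2097152 * ((d : ℝ) + 1) ^ 2) (1 / (512 * ((d : ℝ) + 1))) ∧
      AnalyticOnNhd ℂ (Cc L m η U lev₀ lev₁ (nabla115 η U) levB)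
        {Y : Space115 (L : ℝ) η lev₀ lev₁ (nabla115 η U) | ‖Y‖ < 1 / (512 * ((d : ℝ) + 1))} := by
  obtain ⟨b, aC, εC, hb, haC, hεC, RC⟩ := exists_regime_sectC L m η U lev₀ lev₁ levB hL hα hU1 hreg hlev kH
  exact ⟨b, aC, εC, hb, haC, hεC, RC, prop4Hyp_Cc L m η U lev₀ lev₁ (nabla115 η U) levB hL hα hU1 hreg hlev,
    analyticOnNhd_Cc L m η U lev₀ lev₁ (nabla115 η U) levB hL hα hU1 hreg hlev⟩

/-! ## §6 Non-vacuity: the flat background -/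

include hL hlev in
/-- **NON-VACUITY — the flat background `U ≡ 1`** meets the (31)-window with `α = 0` (`B7Eq122LinearPartIsLinear.one_mem_U1` ∕ `flat_regular`, as in
ne9-leaf-03's `quadAnalytic_Cc_one`): for ANY kernel `k_H` the Sect. C regime of the FLAT one-step averaging holds per lattice with no displayed
hypothesis beyond `1 ≤ L`, `1 ≤ lev₀`. [cite: Balaban1985Variational, Prop. 3 p.289, (44) p.285] -/
theorem exists_regime_sectC_one (kH : Bond d (fineP L m) → Bond d m → (𝔸 →L[ℂ] 𝔸)) :
    ∃ b aC εC : ℝ, 0 ≤ b ∧ 0 < aC ∧ 0 < εC ∧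
      Regime (HopAd (L : ℝ) η levB lev₀ lev₁ (1 : Bond d (fineP L m) → 𝔸ˣ) kH) 0
        (Cc L m η (1 : Bond d (fineP L m) → 𝔸ˣ) lev₀ lev₁ (nabla115 η (1 : Bond d (fineP L m) → 𝔸ˣ)) levB) b 0
        (2097152 * ((d : ℝ) + 1) ^ 2) (1 / (512 * ((d : ℝ) + 1))) 0 aC εC :=
  exists_regime_sectC L m η 1 lev₀ lev₁ levB hL (α := 0) (by norm_num) (fun x κ => B7Eq122LinearPartIsLinear.one_mem_U1 x κ)
    (fun y κ r => B7Eq122LinearPartIsLinear.flat_regular (cornerSite L y) κ r) hlev kH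

end Literature.MathematicalPhysics.QuantumFieldTheory.Balaban1983to89.B11Eq44RegimePerLattice
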